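import Summits.QuantumFields.BalabanUV.T4Continuum.Support.AveragingDeficitFermat
import Summits.QuantumFields.BalabanUV.T4Continuum.Support.NE3EnergyHessBilin
import Summits.QuantumFields.BalabanUV.T4Continuum.Support.NE3TangentCovariantTower
import Summits.QuantumFields.BalabanUV.T4Continuum.Support.NE3SmoothRightInverseFlat
import Summits.QuantumFields.BalabanUV.T4Continuum.Support.NE3FramePotBoundComplex
import Summits.QuantumFields.BalabanUV.T4Continuum.Support.NE3CovariantCalculus
import HarnessLib

/-!
# NE7FlatSliceSourceDuality — row NE7 (node U5), the (A)-bill's END at the trivial flat datum: THE ℓ¹–ℓ^∞ DUALITY SOCKET OF THE SLICE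
# SOLVER LETTER `G♭` — its FUNCTIONAL form (as typed in the END F54 v3, in `NE7FlatSkewSlice` §6 and in `NE7FlatSkewSliceSolvable`) IS
# EQUIVALENT to the SOURCE form a Green's-function estimate delivers; the `k`-UNIFORM constant is NOT touched

Lineage `b2b-balaban-t4-ne7-p2` (CRUX PROVER NE7 #2, co-owner of row NE7), generation 84; sequel of 135 `NE7FlatSkewSlice` (p378872) and 136
`NE7FlatSkewSliceSolvable` (p379148).  Over `AveragingDeficitTorusChart` (`redN`, `boxVec`, `skewP`), `NE3HessForm.hess` ∕ `NE3EnergyHessBilin.hessBilin`,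
`NE3CovariantCalculus.hsR` and Mathlib's Hahn–Banach theorem `exists_extension_norm_eq`.
WHY.  The repaired END (F54 v3) consumes the slice solver letter in FUNCTIONAL form
  `hG′(K_G) : ∀ X skew P-periodic with dirIter L j 1 X = 0, ∀ g ≥ 0, (∀ Y in the same slice, |hess 1 X Y (perWin d P)| ≤ g·‖Y‖_{ℓ¹(periodBox P)})
             → ∀ z μ ≠ ν, ‖curl 1 X (z; μ, ν)‖ ≤ K_G·g`,
because its producer (F44's bootstrap with F48b's expansion remainder) bounds the functional `Y ↦ hess 1 X Y` only in the `ℓ¹`-dual norm, while every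
SUPPLIER — the XL(c) driver: docking of lit-balaban's B5 (1.115) 2nd entry `|∇GJ| ≤ O(1)|J|`, or any other Green's-function estimate — proves a SOURCE bound:
«if `hess 1 X Y = ⟨H, Y⟩` on the slice for a bond SOURCE `H`, then `‖curl 1 X‖_∞ ≤ K·‖H‖_∞`».  Functional ⟹ source of the same size is Hahn–Banach (extension
to all bond fields in the `ℓ¹` norm) + Riesz (on `M_n(ℂ)` through `hsR`).  THIS FILE is that adapter, independent of the docking route: **`sliceSolver_of_sourceSolver`**
(source form with constant `K` ⟹ `hG′` with `K_G = card n · K`) and **`sourceSolver_of_sliceSolver`** (`hG′(K)` ⟹ source form with `K`), both for the END's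
slice `{skew, P-periodic, dirIter L j 1 · = 0}` LITERALLY, over the general statement **`exists_skewSource_of_l1DualBound`** (any real subspace of skew
`P`-periodic fields, any real linear functional).  The factor `card n` is the gap between the operator norm on `M_n(ℂ)` (the tree's norm (19)) and its dual
at the normalisation `Re tr∕n` of `hsR`; the source is delivered SKEW (`𝔲(N)`-valued) and `P`-periodic.
HOW ([folklore]).  §1 (Mathlib only) **`exists_components_of_l1Bound`**: a real functional on a subspace of a finite product `ι → F` bounded by `g·Σ_i ‖v i‖`
is `Σ_i ψ_i (v i)` with `‖ψ_i‖ ≤ g` (Hahn–Banach on the `ℓ¹` copy `PiLp 1`, coordinate injections `axisInj`).  §2 Riesz for `hsR` on `M_n(ℂ)`: **`exists_hsR_repr`**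
(`H ↦ hsR H ·` is injective into the real dual — `hsR H H = ‖H‖²_{HS}∕n` — hence surjective by the finrank count), **`norm_le_card_mul_of_hsR_repr`**
(`‖H‖ ≤ card n·‖ψ‖`, by `MatrixNorms.opNorm_sq_le_card_mul_nhsNormSq`), the skew projection (`hsR_skewP_left`, `norm_skewP_le`).  §3 the SOURCE PAIRING
**`srcPair H Y B = Σ_{x∈B} Σ_κ hsR (H x κ) (Y x κ)`**, `|srcPair H Y B| ≤ ‖H‖_∞·‖Y‖_{ℓ¹(B)}`.  §4 the duality on the torus (`periodBox P` reindexed by `boxVec`,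
periodic extension by `redN`).  §5 the END's slice as a real subspace **`flatSlice`** (linearity of `dirIter L j 1` through `dirIter_flat` and B7's contour
averages `iterate_Tcoarse_add ∕ iterate_Tcoarse_map`) and the two END-shaped corollaries.
HONEST FRAMING (page 1): [folklore] finite-dimensional duality; NO estimate is proved — the content of the (A)-bill's XL(c) driver (the `k`-UNIFORM constant
`K`, PRICING-NE7 v64: critical, unprinted ∕ unproved) is exactly the SOURCE-form hypothesis `hSrc` of `sliceSolver_of_sourceSolver`, displayed, not
discharged; nothing of Bałaban's asserted; NOT (APE), NOT ONE-STEP, NOT NE7; spine 0∕9; finite T⁴ rung (B)+1 — NOT infinite volume, NOT mass gap, NOT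
Clay.  Continuum YM on T⁴ ⇐ BetaPertH ∧ nine spine estimates (0/9 proved); BetaPertH ⇐ (D1) ∧ (D4) ∧ CAP+tail; G-an2-4 gates asym, D1 and NE2/3/4.
-/

set_option autoImplicit false

open scoped BigOperators Matrix Matrix.Norms.L2Operator
open NormedSpace Finset

namespace Summit.QuantumFields.BalabanUV.T4Continuum.NE7FlatSliceSourceDuality

/-! ## §1 `ℓ¹`-duality on a finite product (Mathlib only): Hahn–Banach + coordinate injections -/

section L1Duality

variable {ι : Type*} [Fintype ι] [DecidableEq ι] {F : Type*} [NormedAddCommGroup F] [NormedSpace ℝ F]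

/-- The coordinate injection `F → PiLp 1 (ι → F)` at `i`, as a continuous linear map (an isometry onto the `i`-th axis). [folklore] -/
noncomputable def axisInj (i : ι) : F →L[ℝ] PiLp 1 (fun _ : ι => F) :=
  LinearMap.mkContinuous
    { toFun := fun x => WithLp.toLp 1 (Pi.single i x)
      map_add' := fun x y => by rw [Pi.single_add, WithLp.toLp_add]
      map_smul' := fun c x => by rw [Pi.single_smul, WithLp.toLp_smul, RingHom.id_apply] } 1
    (fun x => by
      rw [one_mul]
      show ‖(WithLp.toLp 1 (Pi.single i x : ι → F) : PiLp 1 (fun _ : ι => F))‖ ≤ ‖x‖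
      rw [PiLp.norm_eq_of_L1, WithLp.ofLp_toLp,
        Finset.sum_eq_single i (fun j _ hj => by rw [Pi.single_eq_of_ne hj, norm_zero]) (fun h => (h (Finset.mem_univ i)).elim),
        Pi.single_eq_same])

/-- `‖axisInj i‖ ≤ 1`. [folklore] -/
theorem norm_axisInj_le (i : ι) : ‖(axisInj i : F →L[ℝ] PiLp 1 (fun _ : ι => F))‖ ≤ 1 :=
  LinearMap.mkContinuous_norm_le _ zero_le_one _

/-- Every element of `PiLp 1 (ι → F)` is the sum of its axis components. [folklore] -/
theorem sum_axisInj (w : PiLp 1 (fun _ : ι => F)) : ∑ i, axisInj i (w i) = w := by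
  have h : ∑ i, axisInj i (w i) = WithLp.toLp 1 (∑ i, Pi.single i (w i)) := by rw [WithLp.toLp_sum]; rfl
  rw [h, Finset.univ_sum_single]

/-- **`ℓ¹`-DUALITY ON A FINITE PRODUCT** (Hahn–Banach): a real linear functional `φ` on a subspace `V` of `ι → F` bounded by `g·Σ_i ‖v i‖` on `V`
is represented by a family of functionals `ψ i : F →L[ℝ] ℝ` of norm `≤ g`: `φ v = Σ_i ψ i (v i)` for `v ∈ V`. [folklore] -/
theorem exists_components_of_l1Bound (V : Submodule ℝ (ι → F)) (φ : V →ₗ[ℝ] ℝ) {g : ℝ} (hg : 0 ≤ g)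
    (hφ : ∀ v : V, |φ v| ≤ g * ∑ i, ‖(v : ι → F) i‖) :
    ∃ ψ : ι → (F →L[ℝ] ℝ), (∀ i, ‖ψ i‖ ≤ g) ∧ ∀ v : V, φ v = ∑ i, ψ i ((v : ι → F) i) := by
  -- the ℓ¹ copy of `ι → F`, the copy `VE` of `V` inside it, the functional `φE` on `VE`
  let eqv : PiLp 1 (fun _ : ι => F) ≃ₗ[ℝ] (ι → F) := WithLp.linearEquiv 1 ℝ (ι → F)
  let VE : Submodule ℝ (PiLp 1 (fun _ : ι => F)) := V.comap eqv.toLinearMap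
  have hmem : ∀ w : VE, eqv (w : PiLp 1 (fun _ : ι => F)) ∈ V := fun w => w.2
  let φE : VE →ₗ[ℝ] ℝ :=
    { toFun := fun w => φ ⟨eqv (w : PiLp 1 (fun _ : ι => F)), hmem w⟩
      map_add' := fun w w' => by rw [← map_add]; congr 1
      map_smul' := fun c w => by rw [RingHom.id_apply, ← map_smul]; congr 1 }
  have hφEb : ∀ w : VE, ‖φE w‖ ≤ g * ‖(w : PiLp 1 (fun _ : ι => F))‖ := fun w => by
    rw [Real.norm_eq_abs, PiLp.norm_eq_of_L1]
    exact hφ ⟨eqv (w : PiLp 1 (fun _ : ι => F)), hmem w⟩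
  -- Hahn–Banach
  obtain ⟨Φ, hΦf, hΦn⟩ := exists_extension_norm_eq VE (φE.mkContinuous g hφEb)
  have hΦg : ‖Φ‖ ≤ g := hΦn.le.trans (LinearMap.mkContinuous_norm_le _ hg _)
  refine ⟨fun i => Φ.comp (axisInj i), fun i => ?_, fun v => ?_⟩
  · calc ‖Φ.comp (axisInj i)‖ ≤ ‖Φ‖ * ‖(axisInj i : F →L[ℝ] PiLp 1 (fun _ : ι => F))‖ := ContinuousLinearMap.opNorm_comp_le _ _
      _ ≤ g * 1 := mul_le_mul hΦg (norm_axisInj_le i) (norm_nonneg _) hg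
      _ = g := mul_one g
  · -- the point `w = toLp v` of `VE`
    have hwV : WithLp.toLp 1 (v : ι → F) ∈ VE := by
      show eqv (WithLp.toLp 1 (v : ι → F)) ∈ V
      exact v.2
    have h1 : Φ (WithLp.toLp 1 (v : ι → F)) = φ v := by
      rw [hΦf ⟨_, hwV⟩, LinearMap.mkContinuous_apply]
      show φ ⟨eqv (WithLp.toLp 1 (v : ι → F)), _⟩ = φ v
      congr 1
    rw [← h1, ← sum_axisInj (WithLp.toLp 1 (v : ι → F)), map_sum]
    rfl

end L1Duality

/-! ## §2 Riesz for the real Hilbert–Schmidt form `hsR` on `M_n(ℂ)`; the skew projection -/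

open Literature.MathematicalPhysics.QuantumFieldTheory.Balaban1983to89
open B7Prop1Explicit B7Prop2Explicit UnitaryModel MatrixNorms
open T4AveragingDeficitWall hiding Site Plane Plaq Bond
open T4AveragingDeficitWallBoundary (periodBox)
open AveragingDeficitPeriodicCounting (IsPeriodicDir)
open MinimalActionLevels (perWin)
open BlockAveragePushDirSplit (flat)
open SmoothRefineNeutral (Tcoarse)
open NE3HessForm (hess)
open NE3TangentCovariantTower (dirIter dirIter_flat)
open NE3EnergyHessBilin (hessBilin hessBilin_apply)
open NE3CovariantCalculus (hsR hsR_self hsR_add_left hsR_add_right hsR_sub_left abs_hsR_le)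
open AveragingDeficitTorusChart (redN skewP skewP_apply skewP_mem redN_boxVec redN_add_smul eq_wrap_add periodic_smul_vec)
open AveragingDeficitFermat (boxVec_redN_mem)

noncomputable section

variable {d : ℕ} {n : Type*} [Fintype n] [DecidableEq n]

local notation "𝕄" => Matrix n n ℂ

omit [DecidableEq n] in
/-- `Re tr∕n` of a real multiple. [folklore] -/
theorem nReTr_real_smul (c : ℝ) (Z : 𝕄) : nReTr (c • Z) = c * nReTr Z := by
  have h := map_smul (nReTrL (n := n)) c Z
  rwa [nReTrL_apply, nReTrL_apply, smul_eq_mul] at h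

omit [DecidableEq n] in
/-- `hsR` is real-homogeneous on the left. [folklore] -/
theorem hsR_smul_left' (c : ℝ) (X Y : 𝕄) : hsR (c • X) Y = c * hsR X Y := by
  unfold NE3CovariantCalculus.hsR
  rw [Matrix.conjTranspose_smul, star_trivial, Matrix.smul_mul, nReTr_real_smul]

omit [DecidableEq n] in
/-- `hsR` is real-homogeneous on the right. [folklore] -/
theorem hsR_smul_right' (c : ℝ) (X Y : 𝕄) : hsR X (c • Y) = c * hsR X Y := by
  unfold NE3CovariantCalculus.hsR
  rw [Matrix.mul_smul, nReTr_real_smul]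

/-- `H ↦ hsR H ·` as a real linear map into the real dual of `M_n(ℂ)`. [folklore] -/
def hsRDual : 𝕄 →ₗ[ℝ] Module.Dual ℝ 𝕄 :=
  LinearMap.mk₂ ℝ (fun H M => hsR H M) (fun H H' M => hsR_add_left H H' M) (fun c H M => hsR_smul_left' c H M)
    (fun H M M' => hsR_add_right H M M') (fun c H M => hsR_smul_right' c H M)

/-- unfolding. [folklore] -/
@[simp] theorem hsRDual_apply (H M : 𝕄) : hsRDual H M = hsR H M := rfl

/-- `H ↦ hsR H ·` is injective: `hsR H H = ‖H‖²_{HS}∕n` dominates `‖H‖²∕n`. [folklore] -/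
theorem hsRDual_injective : Function.Injective (hsRDual (n := n)) := by
  intro H H' h
  rw [← sub_eq_zero]
  have h0 : hsRDual (H - H') (H - H') = 0 := by rw [map_sub hsRDual, h, sub_self, LinearMap.zero_apply]
  rw [hsRDual_apply, hsR_self] at h0
  have h2 := opNorm_sq_le_card_mul_nhsNormSq (H - H'); rw [h0, mul_zero] at h2
  exact norm_eq_zero.mp (by nlinarith [norm_nonneg (H - H')])

/-- **RIESZ FOR `hsR`**: every continuous real linear functional on `M_n(ℂ)` is `hsR H ·` for one matrix `H`. [folklore] -/
theorem exists_hsR_repr (ψ : 𝕄 →L[ℝ] ℝ) : ∃ H : 𝕄, ∀ M, hsR H M = ψ M := by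
  have hsurj : Function.Surjective (hsRDual (n := n)) :=
    (LinearMap.injective_iff_surjective_of_finrank_eq_finrank (Subspace.dual_finrank_eq).symm).mp hsRDual_injective
  obtain ⟨H, hH⟩ := hsurj (ψ : 𝕄 →ₗ[ℝ] ℝ)
  exact ⟨H, fun M => LinearMap.congr_fun hH M⟩

/-- **THE NORM OF THE REPRESENTATIVE**: `‖H‖ ≤ card n · ‖ψ‖` (operator norm against its dual at the normalisation `Re tr∕n`). [folklore] -/
theorem norm_le_card_mul_of_hsR_repr {ψ : 𝕄 →L[ℝ] ℝ} {H : 𝕄} (h : ∀ M, hsR H M = ψ M) : ‖H‖ ≤ Fintype.card n * ‖ψ‖ := by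
  have h1 : ‖H‖ ^ 2 ≤ Fintype.card n * (‖ψ‖ * ‖H‖) := by
    calc ‖H‖ ^ 2 ≤ Fintype.card n * nhsNormSq H := opNorm_sq_le_card_mul_nhsNormSq H
      _ = Fintype.card n * ψ H := by rw [← hsR_self, h]
      _ ≤ Fintype.card n * (‖ψ‖ * ‖H‖) := by
          gcongr
          exact (le_abs_self _).trans (by simpa only [Real.norm_eq_abs] using ψ.le_opNorm H)
  by_cases hH : ‖H‖ = 0
  · rw [hH]; positivity
  · have hpos : 0 < ‖H‖ := lt_of_le_of_ne (norm_nonneg H) (Ne.symm hH)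
    rw [pow_two, ← mul_assoc] at h1
    exact le_of_mul_le_mul_right h1 hpos

omit [DecidableEq n] in
/-- `Re tr∕n (H·Y) = −Re tr∕n (Hᴴ·Y)` for skew `Y`. [folklore] -/
theorem nReTr_mul_skew {Y : 𝕄} (hY : Y ∈ skewAdjoint 𝕄) (H : 𝕄) : nReTr (H * Y) = -nReTr (Hᴴ * Y) := by
  have hYs : Yᴴ = -Y := by rw [← Matrix.star_eq_conjTranspose]; exact skewAdjoint.mem_iff.mp hY
  calc nReTr (H * Y) = nReTr ((H * Y)ᴴ) := (nReTr_conjTranspose _).symm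
    _ = nReTr (-(Y * Hᴴ)) := by rw [Matrix.conjTranspose_mul, hYs, neg_mul]
    _ = -nReTr (Y * Hᴴ) := by rw [← neg_one_smul ℝ (Y * Hᴴ), nReTr_real_smul, neg_one_mul]
    _ = -nReTr (Hᴴ * Y) := by unfold UnitaryModel.nReTr; rw [Matrix.trace_mul_comm]

omit [DecidableEq n] in
/-- **The skew projection is invisible to skew test directions**: `hsR (skewP H) Y = hsR H Y` for skew `Y`. [folklore] -/
theorem hsR_skewP_left {Y : 𝕄} (hY : Y ∈ skewAdjoint 𝕄) (H : 𝕄) : hsR (skewP H) Y = hsR H Y := by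
  unfold NE3CovariantCalculus.hsR
  have e : skewP H = (2⁻¹ : ℝ) • (H - Hᴴ) := by
    rw [skewP_apply, Matrix.star_eq_conjTranspose]
    ext i j
    simp only [Matrix.smul_apply, smul_eq_mul, Complex.real_smul, Complex.ofReal_inv, Complex.ofReal_ofNat]
  rw [e, Matrix.conjTranspose_smul, star_trivial, Matrix.smul_mul, nReTr_real_smul, Matrix.conjTranspose_sub,
    Matrix.conjTranspose_conjTranspose, Matrix.sub_mul]
  unfold UnitaryModel.nReTr
  rw [Matrix.trace_sub, Complex.sub_re, sub_div]
  have h := nReTr_mul_skew hY H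
  unfold UnitaryModel.nReTr at h
  rw [h]
  ring

/-- `‖skewP H‖ ≤ ‖H‖`. [folklore] -/
theorem norm_skewP_le (H : 𝕄) : ‖skewP H‖ ≤ ‖H‖ := by
  rw [skewP_apply, norm_smul, norm_inv, Complex.norm_ofNat]
  calc 2⁻¹ * ‖H - star H‖ ≤ 2⁻¹ * (‖H‖ + ‖star H‖) := by gcongr; exact norm_sub_le _ _
    _ = ‖H‖ := by rw [norm_star]; ring

/-! ## §3 The source pairing -/

/-- **THE SOURCE PAIRING** of a bond source `H` with a direction field `Y` over a set of sites `B`: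
`srcPair H Y B = Σ_{x ∈ B} Σ_κ hsR (H x κ) (Y x κ) = Σ_{x ∈ B} Σ_κ Re tr((H x κ)ᴴ · Y x κ)∕n`. [folklore] -/
def srcPair (H Y : Site d → Fin d → 𝕄) (B : Finset (Site d)) : ℝ := ∑ x ∈ B, ∑ κ : Fin d, hsR (H x κ) (Y x κ)

/-- **`|⟨H, Y⟩_B| ≤ ‖H‖_∞ · ‖Y‖_{ℓ¹(B)}`.** [folklore] -/
theorem abs_srcPair_le {H Y : Site d → Fin d → 𝕄} {B : Finset (Site d)} {g : ℝ} (hH : ∀ (x : Site d) (κ : Fin d), ‖H x κ‖ ≤ g) :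
    |srcPair H Y B| ≤ g * dirL1 Y B := by
  unfold srcPair dirL1
  rw [Finset.mul_sum]
  refine (Finset.abs_sum_le_sum_abs _ _).trans (Finset.sum_le_sum fun x _ => ?_)
  rw [Finset.mul_sum]
  refine (Finset.abs_sum_le_sum_abs _ _).trans (Finset.sum_le_sum fun κ _ => ?_)
  exact (abs_hsR_le _ _).trans (mul_le_mul_of_nonneg_right (hH x κ) (norm_nonneg _))

omit [DecidableEq n] in
/-- **Skew-symmetrising the source is invisible to skew direction fields.** [folklore] -/
theorem srcPair_skewP_left {Y : Site d → Fin d → 𝕄} (hY : IsSkewDir Y) (H : Site d → Fin d → 𝕄) (B : Finset (Site d)) :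
    srcPair (fun x κ => skewP (H x κ)) Y B = srcPair H Y B := by
  simp only [srcPair, hsR_skewP_left (hY _ _)]

/-! ## §4 THE DUALITY on the torus: an `ℓ¹`-dual bound on a subspace of skew periodic fields is realised by a skew periodic source -/

omit [Fintype n] [DecidableEq n] in
/-- Reindexing the period box by the torus index: `Σ_{x ∈ periodBox P} f x = Σ_{r} f (boxVec P r)`. [folklore] -/
theorem sum_periodBox_eq_sum_boxVec {α : Type*} [AddCommMonoid α] (P : ℕ) [NeZero P] (f : Site d → α) :
    ∑ x ∈ periodBox (d := d) P, f x = ∑ r : Fin d → Fin P, f (boxVec P r) := by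
  unfold periodBox
  rw [Finset.sum_image]
  intro r _ r' _ h
  rw [← redN_boxVec P r, ← redN_boxVec P r', h]

omit [Fintype n] [DecidableEq n] in
/-- A `P`-periodic field is the periodic extension of its restriction to the period box: `Y x κ = Y (boxVec P (redN P x)) κ`. [folklore] -/
theorem periodic_eq_boxVec_redN {P : ℕ} [NeZero P] {Y : Site d → Fin d → 𝕄} (hY : IsPeriodicDir Y (P : ℤ)) (x : Site d) (κ : Fin d) :
    Y x κ = Y (boxVec P (redN P x)) κ := by
  conv_lhs => rw [eq_wrap_add P x]
  exact periodic_smul_vec (f := fun y => Y y κ) (fun y i => hY y i κ) _ _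

/-- **THE ℓ¹–ℓ^∞ DUALITY ON THE TORUS.**  Let `S` be a real subspace of SKEW `P`-PERIODIC direction fields and `φ` a real linear functional with
`|φ Y| ≤ g·‖Y‖_{ℓ¹(periodBox P)}` on `S`.  Then there is a SKEW `P`-PERIODIC SOURCE `H` with `‖H x κ‖ ≤ card n · g` and `φ Y = ⟨H, Y⟩_{periodBox P}` on `S`
(Hahn–Banach on the `ℓ¹` torus chart + Riesz for `hsR` bondwise + the skew projection). [folklore] -/
theorem exists_skewSource_of_l1DualBound (P : ℕ) [NeZero P] (S : Submodule ℝ (Site d → Fin d → 𝕄))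
    (hSskew : ∀ Y ∈ S, IsSkewDir Y) (hSper : ∀ Y ∈ S, IsPeriodicDir Y (P : ℤ))
    (φ : (Site d → Fin d → 𝕄) →ₗ[ℝ] ℝ) {g : ℝ} (hg : 0 ≤ g) (hφ : ∀ Y ∈ S, |φ Y| ≤ g * dirL1 Y (periodBox (d := d) P)) :
    ∃ H : Site d → Fin d → 𝕄, IsSkewDir H ∧ IsPeriodicDir H (P : ℤ) ∧ (∀ (x : Site d) (κ : Fin d), ‖H x κ‖ ≤ Fintype.card n * g) ∧
      ∀ Y ∈ S, φ Y = srcPair H Y (periodBox (d := d) P) := by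
  classical
  -- restriction to the torus bonds and periodic extension, as real linear maps
  set res : (Site d → Fin d → 𝕄) →ₗ[ℝ] ((Fin d → Fin P) × Fin d → 𝕄) :=
    { toFun := fun Y i => Y (boxVec P i.1) i.2, map_add' := fun _ _ => rfl, map_smul' := fun _ _ => rfl } with hres
  set ext : ((Fin d → Fin P) × Fin d → 𝕄) →ₗ[ℝ] (Site d → Fin d → 𝕄) :=
    { toFun := fun v x κ => v (redN P x, κ), map_add' := fun _ _ => rfl, map_smul' := fun _ _ => rfl } with hext
  have hext_res : ∀ Y ∈ S, ext (res Y) = Y := by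
    intro Y hY
    funext x κ
    exact (periodic_eq_boxVec_redN (hSper Y hY) x κ).symm
  -- the copy of `S` on the torus and the functional on it
  set V : Submodule ℝ ((Fin d → Fin P) × Fin d → 𝕄) := S.comap ext with hV
  set φV : V →ₗ[ℝ] ℝ := φ ∘ₗ ext ∘ₗ V.subtype with hφV
  have hdirL1 : ∀ v : (Fin d → Fin P) × Fin d → 𝕄, dirL1 (ext v) (periodBox (d := d) P) = ∑ i, ‖v i‖ := by
    intro v
    unfold dirL1
    rw [sum_periodBox_eq_sum_boxVec, Fintype.sum_prod_type]
    refine Finset.sum_congr rfl fun r _ => Finset.sum_congr rfl fun κ _ => ?_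
    show ‖v (redN P (boxVec P r), κ)‖ = ‖v (r, κ)‖
    rw [redN_boxVec]
  have hbound : ∀ v : V, |φV v| ≤ g * ∑ i, ‖(v : (Fin d → Fin P) × Fin d → 𝕄) i‖ := by
    intro v
    rw [← hdirL1]
    exact hφ _ v.2
  obtain ⟨ψ, hψn, hψrep⟩ := exists_components_of_l1Bound V φV hg hbound
  -- Riesz bondwise, then skew projection and periodic extension
  choose Hc hHc using fun i => exists_hsR_repr (ψ i)
  refine ⟨fun x κ => skewP (Hc (redN P x, κ)), fun x κ => skewP_mem _, fun x κ μ => ?_, fun x κ => ?_, fun Y hY => ?_⟩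
  · show skewP (Hc (redN P (x + (P : ℤ) • e κ), μ)) = skewP (Hc (redN P x, μ))
    rw [redN_add_smul]
  · calc ‖skewP (Hc (redN P x, κ))‖ ≤ ‖Hc (redN P x, κ)‖ := norm_skewP_le _
      _ ≤ Fintype.card n * ‖ψ (redN P x, κ)‖ := norm_le_card_mul_of_hsR_repr (hHc _)
      _ ≤ Fintype.card n * g := by gcongr; exact hψn _
  · have hresV : res Y ∈ V := by
      show ext (res Y) ∈ S
      rw [hext_res Y hY]; exact hY
    have h1 : φ Y = φV ⟨res Y, hresV⟩ := by
      show φ Y = φ (ext (res Y))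
      rw [hext_res Y hY]
    rw [h1, hψrep ⟨res Y, hresV⟩, srcPair_skewP_left (hSskew Y hY)]
    unfold srcPair
    rw [sum_periodBox_eq_sum_boxVec, Fintype.sum_prod_type]
    refine Finset.sum_congr rfl fun r _ => Finset.sum_congr rfl fun κ _ => ?_
    beta_reduce
    rw [redN_boxVec, ← hHc]
    rfl

/-! ## §5 The END's slice `{skew, P-periodic, dirIter L j 1 · = 0}` and the two END-shaped corollaries -/

omit [Fintype n] [DecidableEq n] in
/-- A real multiple of a matrix field read through the complex structure. [folklore] -/
theorem real_smul_dirField (c : ℝ) (Y : Site d → Fin d → 𝕄) :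
    (fun y μ => ((c : ℂ) • (LinearMap.id : 𝕄 →ₗ[ℂ] 𝕄)) (Y y μ)) = c • Y := by
  funext y μ
  ext i j
  simp only [LinearMap.smul_apply, LinearMap.id_coe, id_eq, Pi.smul_apply, Matrix.smul_apply, Complex.real_smul, smul_eq_mul]

/-- **THE END's SLICE AS A REAL SUBSPACE**: skew, `P`-periodic direction fields annihilated by the `j`-fold flat linearised average `dirIter L j 1`
(additive and real-homogeneous through `dirIter_flat` and the linearity of B7's contour averages). [folklore] -/
def flatSlice {L : ℕ} (hL : 1 ≤ L) (j P : ℕ) : Submodule ℝ (Site d → Fin d → 𝕄) where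
  carrier := {Y | IsSkewDir Y ∧ IsPeriodicDir Y (P : ℤ) ∧ dirIter L j (flat (d := d) (n := n)) Y = 0}
  add_mem' := by
    rintro Y Z ⟨hYs, hYP, hYT⟩ ⟨hZs, hZP, hZT⟩
    refine ⟨fun x κ => (skewAdjoint 𝕄).add_mem (hYs x κ) (hZs x κ), fun x κ μ => ?_, ?_⟩
    · show Y (x + (P : ℤ) • e κ) μ + Z (x + (P : ℤ) • e κ) μ = Y x μ + Z x μ
      rw [hYP, hZP]
    · rw [dirIter_flat hL, NE3SmoothRightInverseFlat.iterate_Tcoarse_add, ← dirIter_flat hL, ← dirIter_flat hL, hYT, hZT, add_zero]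
  zero_mem' := by
    refine ⟨fun x κ => (skewAdjoint 𝕄).zero_mem, fun x κ μ => rfl, ?_⟩
    have h := NE3SmoothRightInverseFlat.iterate_Tcoarse_add (n := n) (d := d) L j 0 0
    rw [add_zero] at h
    rw [dirIter_flat hL]
    exact left_eq_add.mp h
  smul_mem' := by
    rintro c Y ⟨hYs, hYP, hYT⟩
    refine ⟨fun x κ => skewAdjoint.smul_mem c (hYs x κ), fun x κ μ => ?_, ?_⟩
    · show c • Y (x + (P : ℤ) • e κ) μ = c • Y x μ
      rw [hYP]
    · have h := NE3FramePotBoundComplex.iterate_Tcoarse_map ((c : ℂ) • (LinearMap.id : 𝕄 →ₗ[ℂ] 𝕄)) L j Y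
      rw [real_smul_dirField] at h
      rw [dirIter_flat hL, h]
      funext z κ
      rw [← dirIter_flat hL, hYT]
      simp only [Pi.zero_apply, LinearMap.smul_apply, LinearMap.id_coe, id_eq, smul_zero]

/-- **THE END's LETTER `G♭` FROM A SOURCE BOUND** (`sliceSolver_of_sourceSolver`).  HYPOTHESIS `hSrc` (the SOURCE form — the shape of B5 (1.115)'s 2nd entry,
the (A)-bill's XL(c) driver, NOT proved here): for every `X` in the slice `{skew, P-periodic, dirIter L j 1 X = 0}` and every SKEW `P`-PERIODIC source `H` with
`‖H x κ‖ ≤ g` such that `hess 1 X Y (perWin d P) = ⟨H, Y⟩_{periodBox P}` for all `Y` in the slice, `‖curl 1 X (z; μ, ν)‖ ≤ K·g`.  CONCLUSION: the letter `hG′`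
EXACTLY as typed in the END F54 v3 ∕ `NE7FlatSkewSlice` §6 ∕ `NE7FlatSkewSliceSolvable`, with `K_G = card n · K`. [folklore] -/
theorem sliceSolver_of_sourceSolver {L : ℕ} (hL : 1 ≤ L) (j P : ℕ) [NeZero P] {K : ℝ}
    (hSrc : ∀ X : Site d → Fin d → 𝕄, IsSkewDir X → IsPeriodicDir X (P : ℤ) → dirIter L j (flat (d := d) (n := n)) X = 0 →
      ∀ H : Site d → Fin d → 𝕄, IsSkewDir H → IsPeriodicDir H (P : ℤ) → ∀ g : ℝ, 0 ≤ g → (∀ (x : Site d) (κ : Fin d), ‖H x κ‖ ≤ g) →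
      (∀ Y : Site d → Fin d → 𝕄, IsSkewDir Y → IsPeriodicDir Y (P : ℤ) → dirIter L j (flat (d := d) (n := n)) Y = 0 →
        hess (flat (d := d) (n := n)) X Y (perWin d P) = srcPair H Y (periodBox (d := d) P)) →
      ∀ (z : Site d) (μ ν : Fin d), μ ≠ ν → ‖curlAt (flat (d := d) (n := n)) X z μ ν‖ ≤ K * g) :
    ∀ X : Site d → Fin d → 𝕄, IsSkewDir X → IsPeriodicDir X (P : ℤ) → dirIter L j (flat (d := d) (n := n)) X = 0 → ∀ g : ℝ, 0 ≤ g →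
      (∀ Y : Site d → Fin d → 𝕄, IsSkewDir Y → IsPeriodicDir Y (P : ℤ) → dirIter L j (flat (d := d) (n := n)) Y = 0 →
        |hess (flat (d := d) (n := n)) X Y (perWin d P)| ≤ g * dirL1 Y (periodBox (d := d) P)) →
      ∀ (z : Site d) (μ ν : Fin d), μ ≠ ν → ‖curlAt (flat (d := d) (n := n)) X z μ ν‖ ≤ (Fintype.card n * K) * g := by
  intro X hXs hXP hXT g hg hfun z μ ν hμν
  obtain ⟨H, hHs, hHP, hHb, hrep⟩ := exists_skewSource_of_l1DualBound P (flatSlice (d := d) (n := n) hL j P) (fun Y hY => hY.1)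
    (fun Y hY => hY.2.1) (hessBilin (flat (d := d) (n := n)) (perWin d P) X) hg
    (fun Y hY => by rw [hessBilin_apply]; exact hfun Y hY.1 hY.2.1 hY.2.2)
  have h := hSrc X hXs hXP hXT H hHs hHP (Fintype.card n * g) (by positivity) hHb
    (fun Y hYs hYP hYT => by rw [← hessBilin_apply]; exact hrep Y ⟨hYs, hYP, hYT⟩) z μ ν hμν
  calc ‖curlAt (flat (d := d) (n := n)) X z μ ν‖ ≤ K * (Fintype.card n * g) := h
    _ = Fintype.card n * K * g := by ring

/-- **THE CONVERSE** (`sourceSolver_of_sliceSolver`): the letter `hG′` with constant `K` implies the source form with the same `K` — a source `H` with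
`‖H x κ‖ ≤ g` bounds the Hessian functional by `g·‖Y‖_{ℓ¹(periodBox P)}` (`abs_srcPair_le`).  So the two forms of `G♭` are EQUIVALENT up to the factor
`card n`. [folklore] -/
theorem sourceSolver_of_sliceSolver {L j P : ℕ} {K : ℝ}
    (hG : ∀ X : Site d → Fin d → 𝕄, IsSkewDir X → IsPeriodicDir X (P : ℤ) → dirIter L j (flat (d := d) (n := n)) X = 0 → ∀ g : ℝ, 0 ≤ g →
      (∀ Y : Site d → Fin d → 𝕄, IsSkewDir Y → IsPeriodicDir Y (P : ℤ) → dirIter L j (flat (d := d) (n := n)) Y = 0 →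
        |hess (flat (d := d) (n := n)) X Y (perWin d P)| ≤ g * dirL1 Y (periodBox (d := d) P)) →
      ∀ (z : Site d) (μ ν : Fin d), μ ≠ ν → ‖curlAt (flat (d := d) (n := n)) X z μ ν‖ ≤ K * g) :
    ∀ X : Site d → Fin d → 𝕄, IsSkewDir X → IsPeriodicDir X (P : ℤ) → dirIter L j (flat (d := d) (n := n)) X = 0 →
      ∀ H : Site d → Fin d → 𝕄, IsSkewDir H → IsPeriodicDir H (P : ℤ) → ∀ g : ℝ, 0 ≤ g → (∀ (x : Site d) (κ : Fin d), ‖H x κ‖ ≤ g) →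
      (∀ Y : Site d → Fin d → 𝕄, IsSkewDir Y → IsPeriodicDir Y (P : ℤ) → dirIter L j (flat (d := d) (n := n)) Y = 0 →
        hess (flat (d := d) (n := n)) X Y (perWin d P) = srcPair H Y (periodBox (d := d) P)) →
      ∀ (z : Site d) (μ ν : Fin d), μ ≠ ν → ‖curlAt (flat (d := d) (n := n)) X z μ ν‖ ≤ K * g := by
  intro X hXs hXP hXT H _hHs _hHP g hg hHb hrep z μ ν hμν
  exact hG X hXs hXP hXT g hg (fun Y hYs hYP hYT => by rw [hrep Y hYs hYP hYT]; exact abs_srcPair_le hHb) z μ ν hμν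

end

end Summit.QuantumFields.BalabanUV.T4Continuum.NE7FlatSliceSourceDuality
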